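import Literature.ModelTheory.FiniteModelTheory.ESODefinability
import Mathlib.Combinatorics.SimpleGraph.Coloring.Vertex
import HarnessLib

/-!
# First-order prefix classes of existential second-order logic, and (non-)3-colourability

The PREFIX CLASSES `ESO(∃* w)` of existential second-order logic (Eiter–Gottlob–Gurevich 2000 over
strings; Gottlob–Kolaitis–Schwentick 2004 over graphs): sentences
`∃S₁ … ∃S_m ∃c₁ … ∃c_p Q₁x₁ … Q_k x_k θ` with second-order variables `S̄` of ARBITRARY arities,
`p` leading first-order existential quantifiers ("constants"), a first-order quantifier word
`w = Q₁ … Q_k ∈ {∀, ∃}*` and a quantifier-free matrix `θ` (with equality).  The classes studied in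
the dichotomy papers are e.g. `ESO(∃*∀∃∀)`, `ESO(∃*∀∀)` (NP-hard, Gottlob–Kolaitis–Schwentick 2004,
Thm. 1.1/Fig. 1) versus `ESO(∃*∀*)`, `ESO(∃*∀∃*)`, `ESO(∃*∃*∀)` (regular / polynomial).

Also the test class of Fagin 1993, §5: NON-3-COLOURABILITY `𝒩` of finite graphs, for which
`𝒩 ∈ ∃SO ⟺ NP = coNP` (Fagin 1974 + NP-completeness of 3-colourability; Fagin 1993, Thm. 5.3), so that
"`𝒩` is not a generalized spectrum" is Fagin's form of `NP ≠ coNP` (his generalization of Asser's problem).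

## Contents

* `FOQuant`, `FOQuant.close`, `FOQuant.closePrefix` — first-order quantifier symbols and closing the
  last `w.length` bound variables of a `BoundedFormula` by a word `w` (Mathlib `BoundedFormula.all` /
  `.ex`);
* `ESOSentence.ofPrefix wit w θ`, `ESOSentence.holdsOnTables_ofPrefix_iff` — the sentence
  `∃S̄ ∃c̄ w θ` as an `ESOSentence` (the `p` constants closed by Mathlib `BoundedFormula.exs`);
* `IsPrefixDefinable ar w C` — the class `C` of finite `ar`-structures is definable in `ESO(∃* w)`
  (any second-order arities, any number of constants);
* `adjTable`, `graphOfTables`, `threeColClass`, `nonThreeColClass` — reading a binary table as a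
  finite simple graph (loop-free symmetrisation, Mathlib `SimpleGraph.fromRel`) and the classes of
  3-colourable / non-3-colourable inputs over the vocabulary `[2]` (Mathlib `SimpleGraph.Colorable`).

## Design choices

* DE BRUIJN CONVENTION. `θ : L.BoundedFormula Empty (p + w.length)` has bound variables
  `0, …, p-1` = the constants `c̄` and `p, …, p + k - 1` = the prefix variables `x₁ … x_k`; the word
  `w : List FOQuant` lists the prefix quantifiers FROM THE INSIDE OUT (head = innermost quantifier,
  binding the LAST variable), so that `closePrefix (q :: w) θ = closePrefix w (q.close θ)` typechecks
  without casts.  For the palindromic word `[∀, ∃, ∀]` of `ESO(∃*∀∃∀)` the two readings agree: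
  `closePrefix [.all, .ex, .all] θ = ((θ.all).ex).all = ∀x ∃y ∀z θ(c̄, x, y, z)`.
* INPUTS over `[2]` are arbitrary binary Boolean tables (directed, loops allowed); the GRAPH of a
  table is its loop-free symmetrisation.  A sentence defining `𝒩` on symmetric irreflexive tables
  yields one defining `nonThreeColClass` on all tables (replace `E(u,v)` by
  `(E(u,v) ∨ E(v,u)) ∧ u ≠ v`, same prefix) and conversely by restriction, so (non-)definability
  statements are insensitive to this choice.
* Equality is available in `θ` (Mathlib `BoundedFormula.bdEqual`), as in the cited papers.

## Not here

No dichotomy / hardness theorems for prefix classes (they are NAMED where used), and no proof of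
Fagin 1993, Thm. 5.3; this file is definitions + unfolding lemmas only.

## References

* T. Eiter, G. Gottlob, Y. Gurevich, *Existential second-order logic over strings*, J. ACM 47 (2000), §1–2.
* G. Gottlob, P. G. Kolaitis, T. Schwentick, *Existential second-order logic over graphs: charting the
  tractability frontier*, J. ACM 51 (2004), §1 (prefix classes `ESO(∃* w)`), Thm. 1.1.
* R. Fagin, *Finite-model theory — a personal perspective*, TCS 116 (1993), §5 (non-3-colourability,
  Thm. 5.3), §7 (monadic / binary NP).
-/

namespace Literature.ModelTheory.FiniteModelTheory

open Literature.Computability.Cryptography FirstOrder FirstOrder.Language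

/-! ### First-order quantifier words -/

/-- A first-order quantifier symbol, `∀` or `∃` (letters of a prefix word `w ∈ {∀, ∃}*`).
[Eiter–Gottlob–Gurevich 2000, §2 (prefix classes)] [cite: EiterGottlobGurevich2000, §2] -/
inductive FOQuant : Type
  | all
  | ex
  deriving DecidableEq, Inhabited

namespace FOQuant

variable {L : FirstOrder.Language} {α : Type*}

/-- Apply one quantifier to the LAST bound variable of a bounded formula (Mathlib `BoundedFormula.all`
/ `BoundedFormula.ex`). [folklore] -/
def close {n : ℕ} : FOQuant → L.BoundedFormula α (n + 1) → L.BoundedFormula α n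
  | all, φ => φ.all
  | ex, φ => φ.ex

/-- `∀.close` is `BoundedFormula.all`. [folklore] -/
@[simp] theorem close_all {n : ℕ} (φ : L.BoundedFormula α (n + 1)) : all.close φ = φ.all := rfl

/-- `∃.close` is `BoundedFormula.ex`. [folklore] -/
@[simp] theorem close_ex {n : ℕ} (φ : L.BoundedFormula α (n + 1)) : ex.close φ = φ.ex := rfl

/-- Close the last `w.length` bound variables of `θ` by the quantifier word `w`, listed from the
INSIDE OUT (the head of `w` is the innermost quantifier and binds the last variable):
`closePrefix [q₁, …, q_k] θ = Q_k x_n ⋯ Q₁ x_{n+k-1} θ`. [Eiter–Gottlob–Gurevich 2000, §2]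
[cite: EiterGottlobGurevich2000, §2] -/
def closePrefix {n : ℕ} : (w : List FOQuant) → L.BoundedFormula α (n + w.length) → L.BoundedFormula α n
  | [], θ => θ
  | q :: w, θ => closePrefix w (q.close θ)

/-- The empty word closes nothing. [folklore] -/
@[simp] theorem closePrefix_nil {n : ℕ} (θ : L.BoundedFormula α (n + ([] : List FOQuant).length)) :
    closePrefix [] θ = θ := rfl

/-- The head of the word is applied first (innermost). [folklore] -/
@[simp] theorem closePrefix_cons {n : ℕ} (q : FOQuant) (w : List FOQuant)
    (θ : L.BoundedFormula α (n + (q :: w).length)) :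
    closePrefix (q :: w) θ = closePrefix w (q.close θ) := rfl

/-- Semantics of closing by `∀`. [folklore] -/
@[simp] theorem realize_close_all {M : Type*} [L.Structure M] {n : ℕ} (φ : L.BoundedFormula α (n + 1))
    (v : α → M) (xs : Fin n → M) :
    (all.close φ).Realize v xs ↔ ∀ a : M, φ.Realize v (Fin.snoc xs a) :=
  BoundedFormula.realize_all

/-- Semantics of closing by `∃`. [folklore] -/
@[simp] theorem realize_close_ex {M : Type*} [L.Structure M] {n : ℕ} (φ : L.BoundedFormula α (n + 1))
    (v : α → M) (xs : Fin n → M) :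
    (ex.close φ).Realize v xs ↔ ∃ a : M, φ.Realize v (Fin.snoc xs a) :=
  BoundedFormula.realize_ex

/-- A universal formula stays universal under a word of `∀`'s (so a quantifier-free matrix closed by
`∀^q` is universal, Mathlib `BoundedFormula.IsUniversal`, and is preserved under substructures /
embeddings, `IsUniversal.realize_embedding`). [folklore] -/
theorem isUniversal_closePrefix_replicate_all :
    ∀ (q : ℕ) {n : ℕ} (θ : L.BoundedFormula α (n + (List.replicate q all).length)),
      θ.IsUniversal → (closePrefix (List.replicate q all) θ).IsUniversal
  | 0, _, _, h => h
  | q + 1, _, θ, h => isUniversal_closePrefix_replicate_all q (all.close θ) h.all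

end FOQuant

/-! ### `ESO(∃* w)` sentences and prefix-definability -/

namespace ESOSentence

variable {ar : List ℕ}

/-- The `ESO(∃* w)` sentence `∃S̄ ∃c₁ … ∃c_p w θ`: witness relations of arities `wit`, `p` leading
first-order existentials (the first `p` bound variables of `θ`, closed by Mathlib `BoundedFormula.exs`),
then the prefix word `w` (inside out, `FOQuant.closePrefix`) over the matrix `θ`.
[Gottlob–Kolaitis–Schwentick 2004, §1 (classes `ESO(∃* w)`)] [cite: GottlobKolaitisSchwentick2004, §1] -/
def ofPrefix (wit : List ℕ) {p : ℕ} (w : List FOQuant)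
    (θ : (JointLang ar wit).BoundedFormula Empty (p + w.length)) : ESOSentence ar :=
  ⟨wit, (FOQuant.closePrefix w θ).exs⟩

/-- The witness arities of `ofPrefix wit w θ` are `wit`. [folklore] -/
@[simp] theorem witnessArities_ofPrefix (wit : List ℕ) {p : ℕ} (w : List FOQuant)
    (θ : (JointLang ar wit).BoundedFormula Empty (p + w.length)) :
    (ofPrefix wit w θ).witnessArities = wit := rfl

/-- Unfolding: `∃S̄ ∃c̄ w θ` holds on input tables `R` iff some witness TABLES `W` and some tuple of
constants `cs` make the joint structure satisfy `w θ`. [folklore] -/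
theorem holdsOnTables_ofPrefix_iff (wit : List ℕ) {p : ℕ} (w : List FOQuant)
    (θ : (JointLang ar wit).BoundedFormula Empty (p + w.length)) (n : ℕ) (R : RelTables ar n) :
    (ofPrefix wit w θ).HoldsOnTables n R ↔
      ∃ (W : RelTables wit n) (cs : Fin p → Fin n),
        @BoundedFormula.Realize _ (Fin n) (jointStructure R W) _ _
          (FOQuant.closePrefix w θ) default cs := by
  rw [holdsOnTables_iff]
  refine exists_congr fun W => ?_
  letI := jointStructure R W
  exact BoundedFormula.realize_exs

/-- Unfolding of membership in the model class. [folklore] -/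
theorem mem_modelClass_ofPrefix_iff (wit : List ℕ) {p : ℕ} (w : List FOQuant)
    (θ : (JointLang ar wit).BoundedFormula Empty (p + w.length)) (x : SNPInstance ar) :
    x ∈ (ofPrefix wit w θ).modelClass ↔
      ∃ (W : RelTables wit x.1) (cs : Fin p → Fin x.1),
        @BoundedFormula.Realize _ (Fin x.1) (jointStructure x.2 W) _ _
          (FOQuant.closePrefix w θ) default cs :=
  holdsOnTables_ofPrefix_iff wit w θ x.1 x.2

end ESOSentence

/-- **Definability in the prefix class `ESO(∃* w)`**: some sentence `∃S̄ ∃c̄ w θ` — witness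
relations of ANY arities, ANY number `p` of leading first-order existentials, the fixed first-order
prefix word `w` (listed inside out, see `FOQuant.closePrefix`) and a QUANTIFIER-FREE matrix `θ` with
equality — has exactly `C` as its class of finite models.  E.g. `w = [∀, ∃, ∀]` is `ESO(∃*∀∃∀)` and
`w = List.replicate q ∀` is `ESO(∃*∀^q)`. [Gottlob–Kolaitis–Schwentick 2004, §1; Eiter–Gottlob–Gurevich
2000, §2] [cite: GottlobKolaitisSchwentick2004, §1] -/
def IsPrefixDefinable (ar : List ℕ) (w : List FOQuant) (C : Set (SNPInstance ar)) : Prop :=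
  ∃ (wit : List ℕ) (p : ℕ) (θ : (JointLang ar wit).BoundedFormula Empty (p + w.length)),
    θ.IsQF ∧ (ESOSentence.ofPrefix wit w θ).modelClass = C

/-- A prefix-definable class is `∃SO`-definable. [folklore] -/
theorem IsPrefixDefinable.isESODefinable {ar : List ℕ} {w : List FOQuant} {C : Set (SNPInstance ar)}
    (h : IsPrefixDefinable ar w C) : IsESODefinable ar C := by
  obtain ⟨wit, p, θ, -, hC⟩ := h
  exact ⟨_, hC⟩

/-! ### Binary tables as graphs; (non-)3-colourability -/

/-- The (single, binary) input table of a `[2]`-structure, as a Boolean adjacency function.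
[Fagin 1993, §5] [folklore] -/
def adjTable {n : ℕ} (R : RelTables [2] n) (u v : Fin n) : Bool :=
  R ⟨0, by decide⟩ ![u, v]

/-- The binary vocabulary `[2]` has a single relation symbol, of arity `2`. [folklore] -/
theorem fin_vocab_two_eq (i : Fin [2].length) : i = ⟨0, by decide⟩ := by
  ext
  have h := i.isLt
  simp only [List.length_cons, List.length_nil] at h
  simp only
  omega

/-- … so every symbol has arity `2`. [folklore] -/
theorem arity_vocab_two (i : Fin [2].length) : 2 = [2].get i := by
  rw [fin_vocab_two_eq i]; rfl

/-- The `[2]`-structure (tables) whose single binary table is `f`. [folklore] -/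
def tablesOfAdj {n : ℕ} (f : Fin n → Fin n → Bool) : RelTables [2] n :=
  fun i v => f (v (Fin.cast (arity_vocab_two i) 0)) (v (Fin.cast (arity_vocab_two i) 1))

/-- `adjTable` inverts `tablesOfAdj`. [folklore] -/
@[simp] theorem adjTable_tablesOfAdj {n : ℕ} (f : Fin n → Fin n → Bool) (u v : Fin n) :
    adjTable (tablesOfAdj f) u v = f u v := rfl

/-- The finite simple GRAPH of a binary table: its loop-free symmetrisation (Mathlib
`SimpleGraph.fromRel`). [Fagin 1993, §5 (finite graphs as `{E}`-structures)] [folklore] -/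
def graphOfTables {n : ℕ} (R : RelTables [2] n) : SimpleGraph (Fin n) :=
  SimpleGraph.fromRel fun u v => adjTable R u v = true

/-- Adjacency in the graph of a table: distinct endpoints and an arc in either direction
(Mathlib `SimpleGraph.fromRel_adj`). [folklore] -/
theorem graphOfTables_adj {n : ℕ} (R : RelTables [2] n) (u v : Fin n) :
    (graphOfTables R).Adj u v ↔ u ≠ v ∧ (adjTable R u v = true ∨ adjTable R v u = true) :=
  SimpleGraph.fromRel_adj _ _ _

/-- The class of 3-COLOURABLE finite graphs (inputs over the vocabulary `[2]`, Mathlib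
`SimpleGraph.Colorable`). [Fagin 1993, §5] [cite: Fagin1993, §5] -/
def threeColClass : Set (SNPInstance [2]) :=
  {x | (graphOfTables x.2).Colorable 3}

/-- **Fagin's test class `𝒩`**: the NON-3-COLOURABLE finite graphs.  `𝒩` is a generalized spectrum
(`IsESODefinable [2] nonThreeColClass`) iff `NP = coNP` (Fagin 1993, Thm. 5.3); whether it is one is
Fagin's generalized Asser problem. [Fagin 1993, §5, Thm. 5.3] [cite: Fagin1993, Thm. 5.3] -/
def nonThreeColClass : Set (SNPInstance [2]) :=
  {x | ¬ (graphOfTables x.2).Colorable 3}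

/-- Membership in `threeColClass`, unfolded. [folklore] -/
@[simp] theorem mem_threeColClass_iff (x : SNPInstance [2]) :
    x ∈ threeColClass ↔ (graphOfTables x.2).Colorable 3 := Iff.rfl

/-- Membership in `nonThreeColClass`, unfolded. [folklore] -/
@[simp] theorem mem_nonThreeColClass_iff (x : SNPInstance [2]) :
    x ∈ nonThreeColClass ↔ ¬ (graphOfTables x.2).Colorable 3 := Iff.rfl

/-- `𝒩` is the complement of the class of 3-colourable graphs. [folklore] -/
theorem nonThreeColClass_eq_compl : nonThreeColClass = threeColClassᶜ := rfl

end Literature.ModelTheory.FiniteModelTheory
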